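import Summits.SmoothPoincare4.SmoothPoincare4.Theorems.WeakReductionDescentWeakReductionReducesStubLoopFromGenusThreeAux4
import Literature.Topology.FourManifolds.CircleSurgeryEulerProofs
import Literature.Topology.FourManifolds.CircleSurgeryFundamentalGroupProofs
import Literature.Topology.FourManifolds.LoopSurgeryHomotopySphere

/-!
# Crux `WeakReductionReduces` (stmt-SmoothPoincare4-17908), line `loop_dichotomy` —
# auxiliary file 6 (lead's consolidation): the loop-presentation fact of MSZ16 FOLLOWS from its
# `χ = 0` corollary

Wave 1 of the line left TWO named facts of Meier–Schirmer–Zupan 2016 (arXiv:1507.06561, Thm. 1.2)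
in the tree, one per stub:

* `Literature.Topology.FourManifolds.msz_chiZero_circleProdSphereThree_gk` (stub L₃,
  `SmallTrisectionsChiZero.lean`): a closed connected oriented smooth `X` with a
  `(g; k)`-GK-trisection in the MSZ range (`∃ i, g ≤ kᵢ + 1`) and `Σ kᵢ = g + 2` (`χ(X) = 0`) is
  diffeomorphic to `S¹ × S³`;
* `Literature.Topology.FourManifolds.msz_loopSurgery_homotopySphere_gk` (stub L₅,
  `LoopSurgeryHomotopySphere.lean`): if such an `X` (MSZ range, no `χ` hypothesis) presents a
  homotopy `4`-sphere `M = X_ℓ` by surgery on a smoothly embedded loop, then `M ≅ S⁴`.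

This file proves the second from the first (`helper_mszLoopSurgery_of_chiZero`, a registered
helper of the crux), so that the whole line owes Meier–Schirmer–Zupan ONE fact, the `χ = 0`
corollary.  The proof is the L₃ worker's assembly (`helper_loopFromGenusThree_of_facts`,
auxiliary file 4) with the genus bound `g′ ≤ 3` replaced by the MSZ-range hypothesis it was only
used to produce: `χ(M) = 2` (PROVED, `finRelHomology_of_homotopyEquiv_sphere_four`) and
`χ(M) = χ(X) + 2` (PROVED, `circleSurgery_relEuler_eq_add_two_holds`) give `Σ k = g + 2` through
Gay–Kirby's Remark 2 in general (PROVED, `relEuler_eq_of_isGKTrisection`); the fact gives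
`Φ : X ≅ S¹ × S³`; `π₁(M) = 1` makes `[ℓ]` normally generate `π₁(X)` (PROVED,
`circleSurgery_normalClosure_loop_eq_top_holds`), so `Φ ∘ ℓ` is homotopic to the fibre circle or
its reverse (PROVED, `helper_circleProdSphereThree_loop_homotopic_fibre`), and both surgeries on
such a loop give `S⁴` (PROVED end-game `helper_loopSurgery_circleProdSphereThree_sphereFour`;
Pao 1977, Aranda–Zupan 2025 §2 p. 7).

## References

* J. Meier, T. Schirmer, A. Zupan, Proc. AMS 144 (2016), arXiv:1507.06561: Thm. 1.2,
  Remark 3.12. [MeierSchirmerZupan2016]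
* R. Aranda, A. Zupan, arXiv:2503.04607 (2025): §2 p. 7, §5–§6. [ArandaZupan2025]
* P. S. Pao, Trans. AMS 227 (1977). [Pao1977]
-/

-- the registered namespace `Summit.SmoothPoincare4.SmoothPoincare4.Theorems…` repeats a component
set_option linter.dupNamespace false

noncomputable section

open scoped Manifold ContDiff Topology ContinuousMap
open Set Function
open Literature.Topology.FourManifolds
open Literature.AlgebraicTopology.SingularHomology Literature.AlgebraicTopology.Homotopy

namespace Summit.SmoothPoincare4.SmoothPoincare4.Theorems.WeakReductionReduces.LoopDichotomy

/-- **The loop-presentation corollary of MSZ16 Thm. 1.2 from its `χ = 0` corollary** (registered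
helper `helper_mszLoopSurgery_of_chiZero` of crux stmt-SmoothPoincare4-17908, line
`loop_dichotomy`): `msz_chiZero_circleProdSphereThree_gk → msz_loopSurgery_homotopySphere_gk`.
If a closed connected oriented smooth `X` with a `(g; k)`-GK-trisection in the MSZ range
(`∃ i, g ≤ kᵢ + 1`) presents a smooth homotopy `4`-sphere `M` by surgery on a smoothly embedded
loop `ℓ` (`IsCircleSurgery`, either framing), then `χ(X) = χ(M) − 2 = 0`, i.e. `Σ kᵢ = g + 2`
(Gay–Kirby Remark 2, PROVED in general), so the `χ = 0` corollary gives `X ≅ S¹ × S³`; `[ℓ]`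
normally generates `π₁(X) ≅ ℤ` (PROVED), hence `ℓ` is homotopic to the fibre circle or its
reverse (PROVED) and both surgeries give `S⁴` (PROVED end-game; Pao 1977).  Conditional only on
the hypothesis (D-0014). [cite: MeierSchirmerZupan2016, Thm. 1.2 (arXiv numbering) and Remark 3.12]
[cite: ArandaZupan2025, §2 p. 7] [cite: Pao1977, Thm] -/
theorem helper_mszLoopSurgery_of_chiZero :
    Literature.Topology.FourManifolds.msz_chiZero_circleProdSphereThree_gk.{0} →
      Literature.Topology.FourManifolds.msz_loopSurgery_homotopySphere_gk := by
  intro hMSZ X _ _ _ _ _ _ _ hoX g' k' T' hT hrange ℓ hℓ M _ _ _ _ _ e hsurg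
  haveI := Fact.mk (@finrank_euclideanSpace_fin ℝ _ 2)
  haveI := Fact.mk (@finrank_euclideanSpace_fin ℝ _ 4)
  haveI := Fact.mk (@finrank_euclideanSpace_fin ℝ _ 5)
  -- topology of `X` and `M`
  haveI : PathConnectedSpace X := pathConnectedSpace_of_isGKTrisection hT
  haveI : CompactSpace M := compactSpace_of_homotopyEquiv_sphere_four_holds M e
  haveI : SimplyConnectedSpace (Metric.sphere (0 : EuclideanSpace ℝ (Fin 5)) 1) :=
    simplyConnectedSpace_sphere_four_holds
  haveI : SimplyConnectedSpace M := e.simplyConnectedSpace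
  -- an orientation of `X`
  obtain ⟨oX⟩ := hoX
  -- `χ(X) = 0`, i.e. `Σ k = g + 2`
  have hEM : relEuler ℤ ℤ M ∅ = 2 := (finRelHomology_of_homotopyEquiv_sphere_four e).2
  have hEX := relEuler_eq_of_isGKTrisection hT
  have hME := circleSurgery_relEuler_eq_add_two_holds X ℓ hℓ M hsurg
  have hsum : k' 0 + k' 1 + k' 2 = g' + 2 := by
    push_cast at hEX
    omega
  -- MSZ: `X ≅ S¹ × S³`
  obtain ⟨Φ⟩ := hMSZ X oX g' k' T' hT hrange hsum
  -- `π₁`: the loop normally generates `π₁(X)`, hence `Φ ∘ ℓ` is the fibre circle up to homotopy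
  let ℓc : C((Metric.sphere (0 : EuclideanSpace ℝ (Fin 2)) 1), X) := ⟨ℓ, hℓ.isEmbedding.continuous⟩
  let Φc : C(X, _) := ⟨Φ, Φ.continuous⟩
  have hN := circleSurgery_normalClosure_loop_eq_top_holds X ℓc hℓ M hsurg
  have hN' : Subgroup.normalClosure
      {(FundamentalGroup.fromPath (Path.Homotopic.Quotient.mk (Φc.comp ℓc).circleLoop) :
        FundamentalGroup _ ((Φc.comp ℓc) (circlePoint 0)))} = ⊤ := by
    let ε := Homeomorph.fundamentalGroupCongr Φ.toHomeomorph (x := ℓ (circlePoint 0)) rfl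
    have hsurj : Function.Surjective ε.toMonoidHom := ε.surjective
    have himg := congrArg (Subgroup.map ε.toMonoidHom) hN
    rw [Subgroup.map_normalClosure _ _ hsurj, Set.image_singleton,
      Subgroup.map_top_of_surjective _ hsurj] at himg
    convert himg using 3
    rw [MulEquiv.coe_toMonoidHom, Homeomorph.fundamentalGroupCongr_apply,
      Literature.AlgebraicTopology.FundamentalGroup.mapOfEq_fromPath]
    rfl
  have hhom := helper_circleProdSphereThree_loop_homotopic_fibre (Φc.comp ℓc) hN'
  -- the end-game
  exact helper_loopSurgery_circleProdSphereThree_sphereFour X Φ ℓc hℓ hhom M hsurg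

end Summit.SmoothPoincare4.SmoothPoincare4.Theorems.WeakReductionReduces.LoopDichotomy

end
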